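import Summits.RiemannHypothesis.RiemannHypothesis.Theorems.MotivicDoor.AWS.Plumbing
import Mathlib.LinearAlgebra.QuadraticForm.Signature

/-!
# AWS plumbing II: signature bookkeeping (Sylvester) and nondegeneracy transfer on `L ⊗ ℝ`

HONEST LABEL (verbatim on every AWS file).  One-way implication from a strengthened, prime-side-only
axiom system; the existence of such an object is NOT claimed and is the located gap; the converse
(RH ⇒ existence) is out of scope and, for this axiom system, tautological rather than informative
(HOME `AXIOM-CONTENT.md` §2; `AWS/Tautological`, `AWS/CanonicalCarrier`; REFEREE-1 B36/B39):
`Nonempty ArithmeticWeilSurface` is a restatement of RH in structure clothing, NOT evidence for RH.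
Framing: lottery ticket at the motivic door; RH probability negligible; consolation
prizes are real: a new semi-local Weil-positivity theorem, or a located gap in the Connes–Consani
programme, plus the ff-door theorem.  Nothing in this file mentions `ζ`, its zeros or
`RiemannHypothesis`: it is linear algebra over the structure `ArithmeticWeilSurface` of
`Theorems/MotivicDoorAWSStructure` (AWS sprint part (d), plumbing; seat aws-1).

## Contents (all PROVED)

* `interBC_sq_le_of_perp` — Cauchy–Schwarz for the (negative semidefinite) form on `⟨E₁,E₂⟩^⊥`;
* `interBC_self_nonpos_of_orthogonal`, `interBC_mul_le_sq` — POSITIVE INDEX ≤ 1: two classes of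
  positive square are never orthogonal; the light-cone inequality `x² > 0 ⇒ x²·y² ≤ (x·y)²`
  (Hodge index in the form used for surfaces, Hartshorne V.1.9);
* `interBC_eq_zero_of_null_prim`, `interBC_eq_of_prim_null` — NONDEGENERACY TRANSFER: a class
  orthogonal to the rulings with self-intersection `0` is in the radical of the real form;
* Frobenius cycles in `L ⊗ ℝ`: `interBC_prim_cycleℝ` (`(prim D(u_c))² = −Re Q(u_c)`,
  i.e. `weilForm_eq_of_arithmeticWeilSurface` transported), and the Castelnuovo–Severi EQUALITY
  case `inter_cycle_eq_of_weilQuadratic_eq_zero`: a cycle with `Re Q(u_c) = 0` is numerically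
  equivalent to `(∫f du) e₁ + (∫f d*u) e₂`;
* SYLVESTER in Mathlib's vocabulary (`sigPos`, `Mathlib.LinearAlgebra.QuadraticForm.Signature`):
  `sigPos_restrict_le_one` (every finite-dimensional subspace of `L ⊗ ℝ` carries at most one
  positive square) and `sigPos_restrict_eq_one` (exactly one if it contains `E₁ + E₂`).
-/

noncomputable section

open TensorProduct Literature.NumberTheory.LFunctions Literature.NumberTheory.ConnesConsani2019
open scoped BigOperators

namespace Summit.RiemannHypothesis.RiemannHypothesis.Theorems.MotivicDoor.AWS

namespace ArithmeticWeilSurface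

variable (X : ArithmeticWeilSurface)

/-! ### Signature bookkeeping: Cauchy–Schwarz on `⟨E₁,E₂⟩^⊥`, light cone, radical -/

/-- **Cauchy–Schwarz for the negative semidefinite form on `⟨E₁,E₂⟩^⊥`**:
`(p·q)² ≤ (p·p)(q·q)` for `p, q ⊥ E₁, E₂`. -/
theorem interBC_sq_le_of_perp {p q : X.Lℝ} (hp₁ : X.interBC p X.E₁ = 0) (hp₂ : X.interBC p X.E₂ = 0)
    (hq₁ : X.interBC q X.E₁ = 0) (hq₂ : X.interBC q X.E₂ = 0) :
    X.interBC p q ^ 2 ≤ X.interBC p p * X.interBC q q := by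
  have hqp : X.interBC q p = X.interBC p q := X.interBC_comm _ _
  -- `(p + t q)² ≤ 0` for every real `t`
  have hneg : ∀ t : ℝ,
      X.interBC p p + 2 * t * X.interBC p q + t ^ 2 * X.interBC q q ≤ 0 := by
    intro t
    have h := X.interBC_self_nonpos_of_perp (p + t • q)
      (by simp [map_add, LinearMap.add_apply, map_smul, LinearMap.smul_apply, hp₁, hq₁])
      (by simp [map_add, LinearMap.add_apply, map_smul, LinearMap.smul_apply, hp₂, hq₂])
    have hexp : X.interBC (p + t • q) (p + t • q) =
        X.interBC p p + 2 * t * X.interBC p q + t ^ 2 * X.interBC q q := by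
      simp only [map_add, LinearMap.add_apply, map_smul, LinearMap.smul_apply, smul_eq_mul, hqp]
      ring
    linarith [hexp ▸ h]
  have hpp : X.interBC p p ≤ 0 := by simpa using hneg 0
  have hqq : X.interBC q q ≤ 0 := X.interBC_self_nonpos_of_perp q hq₁ hq₂
  rcases hqq.lt_or_eq with hqq' | hqq'
  · -- `q·q < 0`: evaluate at `t = -(p·q)/(q·q)`
    have h := hneg (-(X.interBC p q) / X.interBC q q)
    have hq0 : X.interBC q q ≠ 0 := hqq'.ne
    have : X.interBC p p + 2 * (-(X.interBC p q) / X.interBC q q) * X.interBC p q +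
        (-(X.interBC p q) / X.interBC q q) ^ 2 * X.interBC q q =
        X.interBC p p - X.interBC p q ^ 2 / X.interBC q q := by
      field_simp
      ring
    rw [this] at h
    have h' : X.interBC p q ^ 2 / X.interBC q q * X.interBC q q = X.interBC p q ^ 2 := by
      field_simp
    nlinarith [h, h', hqq']
  · -- `q·q = 0`: then `p·q = 0`
    have hpq : X.interBC p q = 0 := by
      by_contra hne
      -- take `t` large of the right sign
      have h := hneg (-(X.interBC p p - 1) / (2 * X.interBC p q))
      rw [hqq'] at h
      have : X.interBC p p + 2 * (-(X.interBC p p - 1) / (2 * X.interBC p q)) * X.interBC p q =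
          1 := by
        field_simp
        ring
      linarith [this]
    rw [hpq, hqq']
    simp

/-- **Positive index ≤ 1, step 1**: two classes of positive square are never orthogonal. -/
theorem interBC_self_nonpos_of_orthogonal {x y : X.Lℝ} (hx : 0 < X.interBC x x)
    (hxy : X.interBC x y = 0) : X.interBC y y ≤ 0 := by
  by_contra hy
  push Not at hy
  set α := X.interBC x X.E₁
  set β := X.interBC x X.E₂
  set γ := X.interBC y X.E₁
  set δ := X.interBC y X.E₂
  have hxx := X.interBC_self_eq_prim x
  have hyy := X.interBC_self_eq_prim y
  have hxy' := X.interBC_eq_prim x y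
  have hpp := X.interBC_prim_self_nonpos x
  have hqq := X.interBC_prim_self_nonpos y
  have hCS := X.interBC_sq_le_of_perp (X.interBC_prim_E₁ x) (X.interBC_prim_E₂ x)
    (X.interBC_prim_E₁ y) (X.interBC_prim_E₂ y)
  set P := X.interBC (X.prim x) (X.prim x)
  set Q := X.interBC (X.prim y) (X.prim y)
  set S := X.interBC (X.prim x) (X.prim y)
  -- `0 ≤ -P < 2αβ`, `0 ≤ -Q < 2γδ`
  have h1 : -P < 2 * (α * β) := by linarith
  have h2 : -Q < 2 * (γ * δ) := by linarith
  have h5 : -P * -Q < 2 * (α * β) * (2 * (γ * δ)) :=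
    mul_lt_mul'' h1 h2 (by linarith) (by linarith)
  have h6 : 4 * (α * β) * (γ * δ) ≤ (α * δ + β * γ) ^ 2 := by
    nlinarith [sq_nonneg (α * δ - β * γ)]
  have h7 : S = -(α * δ + β * γ) := by linarith
  have h8 : S ^ 2 = (α * δ + β * γ) ^ 2 := by rw [h7]; ring
  nlinarith [hCS, h5, h6, h8]

/-- **Light-cone inequality (positive index ≤ 1)**: if `x² > 0` then `x² · y² ≤ (x·y)²` for every
`y` (reverse Cauchy–Schwarz; Hodge index in the form used for surfaces, Hartshorne V.1.9). -/
theorem interBC_mul_le_sq {x : X.Lℝ} (hx : 0 < X.interBC x x) (y : X.Lℝ) :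
    X.interBC x x * X.interBC y y ≤ X.interBC x y ^ 2 := by
  set t := X.interBC x y / X.interBC x x with ht
  have hyx : X.interBC y x = X.interBC x y := X.interBC_comm _ _
  have horth : X.interBC x (y - t • x) = 0 := by
    simp only [map_sub, map_smul, smul_eq_mul, ht]
    field_simp
    ring
  have h := X.interBC_self_nonpos_of_orthogonal hx horth
  have hexp : X.interBC (y - t • x) (y - t • x) =
      X.interBC y y - X.interBC x y ^ 2 / X.interBC x x := by
    simp only [map_sub, LinearMap.sub_apply, map_smul, LinearMap.smul_apply, smul_eq_mul, hyx, ht]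
    field_simp
    ring
  rw [hexp] at h
  have hxx : X.interBC x x ≠ 0 := hx.ne'
  have : X.interBC x y ^ 2 / X.interBC x x * X.interBC x x = X.interBC x y ^ 2 := by
    field_simp
  nlinarith [h, this, hx]

/-- **Nondegeneracy transfer**: a class orthogonal to the rulings with self-intersection `0` is in
the RADICAL of the real form (the form on `⟨E₁,E₂⟩^⊥` is negative semidefinite, so its null
vectors are radical vectors there, and `⟨E₁,E₂⟩` is split off orthogonally by `prim`). -/
theorem interBC_eq_zero_of_null_prim {z : X.Lℝ} (h₁ : X.interBC z X.E₁ = 0)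
    (h₂ : X.interBC z X.E₂ = 0) (h0 : X.interBC z z = 0) (w : X.Lℝ) : X.interBC z w = 0 := by
  have hCS := X.interBC_sq_le_of_perp h₁ h₂ (X.interBC_prim_E₁ w) (X.interBC_prim_E₂ w)
  rw [h0, zero_mul] at hCS
  have hzp : X.interBC z (X.prim w) = 0 := by nlinarith [sq_nonneg (X.interBC z (X.prim w))]
  simp only [prim_apply, map_sub, map_smul, smul_eq_mul, h₁, h₂, mul_zero, sub_zero] at hzp
  exact hzp

/-- The same for the primitive part of any class: if `(prim z)² = 0` then `prim z` is radical, i.e.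
`z` is numerically equivalent to `(z·E₂) E₁ + (z·E₁) E₂`. -/
theorem interBC_eq_of_prim_null {z : X.Lℝ} (h0 : X.interBC (X.prim z) (X.prim z) = 0)
    (w : X.Lℝ) :
    X.interBC z w = X.interBC z X.E₂ * X.interBC X.E₁ w + X.interBC z X.E₁ * X.interBC X.E₂ w := by
  have h := X.interBC_eq_zero_of_null_prim (X.interBC_prim_E₁ z) (X.interBC_prim_E₂ z) h0 w
  simp only [prim_apply, map_sub, LinearMap.sub_apply, map_smul, LinearMap.smul_apply, smul_eq_mul]
    at h
  linarith

/-! ### Frobenius cycles in `L ⊗ ℝ` -/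

/-- The real class of the Frobenius cycle `D(u_c)`. -/
def cycleℝ (c : X.gen.ι →₀ ℤ) : X.Lℝ := X.toLℝ (X.cycle c)

/-- `D(u_c)·E₁ = ∫ f d*u` in `L ⊗ ℝ`. -/
@[simp] theorem interBC_cycleℝ_E₁ (c : X.gen.ι →₀ ℤ) :
    X.interBC (X.cycleℝ c) X.E₁ = massDstar (toMul (X.test c)) := by
  simp [cycleℝ, E₁]

/-- `D(u_c)·E₂ = ∫ f du` in `L ⊗ ℝ`. -/
@[simp] theorem interBC_cycleℝ_E₂ (c : X.gen.ι →₀ ℤ) :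
    X.interBC (X.cycleℝ c) X.E₂ = massDu (toMul (X.test c)) := by
  simp [cycleℝ, E₂]

/-- `D(u_c)² = 2 𝔰(f,f)` in `L ⊗ ℝ`. -/
@[simp] theorem interBC_cycleℝ_cycleℝ (c : X.gen.ι →₀ ℤ) :
    X.interBC (X.cycleℝ c) (X.cycleℝ c) = 2 * ccPairing (toMul (X.test c)) (toMul (X.test c)) := by
  simp [cycleℝ]

/-- **The primitive Frobenius class has square `−Re Q(u_c)`** (`weilForm_eq_of_arithmeticWeilSurface`
transported to `L ⊗ ℝ`). -/
theorem interBC_prim_cycleℝ (c : X.gen.ι →₀ ℤ) :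
    X.interBC (X.prim (X.cycleℝ c)) (X.prim (X.cycleℝ c)) =
      -(weilQuadratic fun t ↦ (X.test c t : ℂ)).re := by
  have h := X.interBC_self_eq_prim (X.cycleℝ c)
  have hw := X.weilForm_eq_of_arithmeticWeilSurface c
  rw [interBC_cycleℝ_cycleℝ, interBC_cycleℝ_E₁, interBC_cycleℝ_E₂] at h
  rw [inter_cycle_cycle, inter_cycle_e₁, inter_cycle_e₂] at hw
  linarith

/-- **Castelnuovo–Severi EQUALITY case**: if `Re Q(u_c) = 0` (a Weil-extremal combination of the
generators) then the cycle `D(u_c)` is numerically equivalent, over `ℝ`, to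
`(∫ f du) e₁ + (∫ f d*u) e₂`: its pairing with every real class is read off the two degrees. -/
theorem interBC_cycleℝ_eq_of_weilQuadratic_eq_zero (c : X.gen.ι →₀ ℤ)
    (h0 : (weilQuadratic fun t ↦ (X.test c t : ℂ)).re = 0) (w : X.Lℝ) :
    X.interBC (X.cycleℝ c) w =
      massDu (toMul (X.test c)) * X.interBC X.E₁ w +
        massDstar (toMul (X.test c)) * X.interBC X.E₂ w := by
  have h := X.interBC_eq_of_prim_null (z := X.cycleℝ c) (by rw [interBC_prim_cycleℝ, h0, neg_zero]) w
  simpa using h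

/-- The same read on the lattice: `D(u_c)·y = (∫ f du)(e₁·y) + (∫ f d*u)(e₂·y)` for every `y ∈ L`. -/
theorem inter_cycle_eq_of_weilQuadratic_eq_zero (c : X.gen.ι →₀ ℤ)
    (h0 : (weilQuadratic fun t ↦ (X.test c t : ℂ)).re = 0) (y : X.L) :
    X.inter (X.cycle c) y =
      massDu (toMul (X.test c)) * X.inter X.e₁ y + massDstar (toMul (X.test c)) * X.inter X.e₂ y := by
  have h := X.interBC_cycleℝ_eq_of_weilQuadratic_eq_zero c h0 (X.toLℝ y)
  simpa [cycleℝ, E₁, E₂, interBC_toLℝ] using h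

/-! ### Sylvester: exactly one positive square on every finite-dimensional subspace ∋ `E₁ + E₂` -/

/-- The real intersection form as a quadratic form on `L_ℝ`. -/
def quadBC : QuadraticForm ℝ X.Lℝ := LinearMap.BilinMap.toQuadraticMap X.interBC

/-- `quadBC z = z·z`. -/
@[simp] theorem quadBC_apply (z : X.Lℝ) : X.quadBC z = X.interBC z z := rfl

/-- **Positive index ≤ 1 (Sylvester bookkeeping)**: on every finite-dimensional subspace `V ⊂ L_ℝ`
the restricted form has at most ONE positive square — `QuadraticForm.sigPos`, the maximal dimension
of a positive definite subspace, is `≤ 1` (its hyperplane `V ∩ (E₁ + E₂)^⊥` is nonpositive). -/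
theorem sigPos_restrict_le_one (V : Submodule ℝ X.Lℝ) [FiniteDimensional ℝ V] :
    sigPos (X.quadBC.restrict V) ≤ 1 := by
  let f : V →ₗ[ℝ] ℝ := (X.interBC.flip (X.E₁ + X.E₂)).comp V.subtype
  have hK : ∀ x ∈ LinearMap.ker f, (X.quadBC.restrict V) x ≤ 0 := by
    intro x hx
    rw [LinearMap.mem_ker] at hx
    exact X.interBC_self_nonpos_of_perp_sum x hx
  have h1 := QuadraticForm.sigPos_add_finrank_le_of_nonpos hK
  have h2 := f.finrank_range_add_finrank_ker
  have h3 : Module.finrank ℝ (LinearMap.range f) ≤ 1 :=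
    (Submodule.finrank_le _).trans (Module.finrank_self ℝ).le
  omega

/-- **Signature `(1, ·)`**: on every finite-dimensional subspace of `L_ℝ` containing `E₁ + E₂`
(e.g. every truncation level) the form has EXACTLY one positive square. -/
theorem sigPos_restrict_eq_one (V : Submodule ℝ X.Lℝ) [FiniteDimensional ℝ V]
    (hV : X.E₁ + X.E₂ ∈ V) : sigPos (X.quadBC.restrict V) = 1 := by
  refine le_antisymm (X.sigPos_restrict_le_one V) ?_
  set v₀ : V := ⟨X.E₁ + X.E₂, hV⟩ with hv₀def
  have hv₀ : (X.quadBC.restrict V) v₀ = 2 := X.interBC_E₁_add_E₂_self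
  have hne : v₀ ≠ 0 := by
    intro h
    rw [h, map_zero] at hv₀
    norm_num at hv₀
  have hPD : ((X.quadBC.restrict V).restrict (ℝ ∙ v₀)).PosDef := by
    rintro ⟨x, hx⟩ hx0
    obtain ⟨c, rfl⟩ := Submodule.mem_span_singleton.mp hx
    have hc : c ≠ 0 := by
      rintro rfl
      exact hx0 (by simp)
    have h : ((X.quadBC.restrict V).restrict (ℝ ∙ v₀)) ⟨c • v₀, hx⟩ = c * c * 2 := by
      rw [QuadraticMap.restrict_apply, QuadraticMap.map_smul, hv₀, smul_eq_mul]
    rw [h]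
    exact mul_pos (mul_self_pos.mpr hc) two_pos
  have h := le_sigPos_of_posDef (X.quadBC.restrict V) hPD
  rwa [finrank_span_singleton hne] at h

end ArithmeticWeilSurface

end Summit.RiemannHypothesis.RiemannHypothesis.Theorems.MotivicDoor.AWS
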